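import Summits.QuantumFields.YangMills.Theorems.BalabanLadderUVSeamRecCeilingsProductMomentsSecondOrder
import HarnessLib

/-!
# Crux `UVSeamRec` (stmt-QuantumFields-20043): the second-order product currency (PM₂) as a TOOLED binder — pinning of the
# reference values, recentring both ways, and the press-button to the registered `stub_ceilings` conclusion

Helper file (`--supports stmt-QuantumFields-20043`) of the stub-helper seat `ym-20043-seam-s2` (lane S-A, gen 2); sequel of
`…CeilingsProductMomentsSecondOrder.lean` (p548315: (RM) ⇒ (PM₂) ⇒ (PM); (PM₂) singleton ⇒ the floors' mean-square law).  With
this file (PM₂) — `⟨∏_{i∈T}(1 + Yᵢ + Yᵢ²/2)⟩_{2L+1,β} ≤ exp(B·#T)`, `Yᵢ = (R⁴/C₁)|kerE_{cube i}(plane_i) − p (q i) β|` — has the same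
kernel-checked toolkit as (RM) (p540020/p541199/p545554) and (PM) (p544257), so that a v6 re-keying of the measure-side stub to
(PM₂), if the owner ever opens it, is turnkey on the consumption side:

* §1 `prod_response₂_recentre_le`, `torusE_prod_response₂_recentre` — recentring a second-order response product at one
  coupling/torus/family: centres within `δ ≥ 0` cost `exp((R⁴/C₁)δ·#T)`
  (`1 + λ(u+δ) + λ²(u+δ)²/2 ≤ (1 + λu + λ²u²/2)(1 + λδ + λ²δ²/2)` and `1 + y + y²/2 ≤ eʸ`).
* §2 **`abs_torusE_plane_sub_le_of_productMoments₂`** — (PM₂) pins its reference values: `|⟨plane q x⟩_{2L+1,β} − p q β| ≤ C₁(e^B − 1)/R⁴`.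
* §3 **`productMoments₂Centred_of_productMoments₂`** ((PM₂)[p, B] ⇒ centred at the torus means [B + e^B − 1]) and
  **`productMoments₂_of_centred_of_pinned`** (centred [B] + pinning D/R⁴ ⇒ (PM₂)[p, B + D/C₁]).
* §4 **`stubCeilings_of_productMoments₂`** — (PM₂) at a unit `a ≤ c·uRec` eventually ⇒ `MomentBounds6 (SU(2)) rF Transport.uRec`, the
  registered `stub_ceilings` conclusion VERBATIM (through p548315 ⊕ p544257).

HONEST FRAMING: consumption-side bookkeeping for an OPEN currency of a CONDITIONAL chain; nothing of E0′; not a gap, not Clay.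

References: `1 + y + y²/2 ≤ eʸ` (Mathlib `Real.quadratic_le_exp_of_nonneg`); Georgii (2011) Thm. 4.17 via p540020.
-/

set_option autoImplicit false

noncomputable section

open MeasureTheory Filter Topology Finset
open Literature.Probability.LatticeModels
open Literature.MathematicalPhysics.QuantumFieldTheory (GaugeConfig wilsonMeasure isProbabilityMeasure_wilsonMeasure
  measurable_torusLift LatticeRep)
open Literature.MathematicalPhysics.QuantumLattice
open Summit.QuantumFields.YangMills.Cruxes.OSLegsFromFemtoAndGap.DlrCollarTransfer
open Summit.QuantumFields.YangMills.Cruxes.UVSeamRec.TemperedResponse (continuous_kerE_plane)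
open Summit.QuantumFields.YangMills.Cruxes.UVSeamRec.ResponsePinning (torusE_mono torusE_const torusE_const_mul')

namespace Summit.QuantumFields.YangMills.Cruxes.UVSeamRec.ProductMoments

variable {G : Type} [Group G] [TopologicalSpace G] [IsTopologicalGroup G] [CompactSpace G]
  [MeasurableSpace G] [BorelSpace G] (r : LatticeRep G) (a : ℝ → ℝ)

/-! ## §1 Recentring a second-order response product -/

/-- One factor: with `u' ≤ u + δ` (`u, u', δ, λ ≥ 0`),
`1 + λu' + (λu')²/2 ≤ (1 + λu + (λu)²/2)·(1 + λδ + (λδ)²/2)`. [folklore] -/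
theorem one_add_quad_le_mul {lam u u' δ : ℝ} (hlam : 0 ≤ lam) (hu : 0 ≤ u) (hu' : 0 ≤ u') (hδ : 0 ≤ δ)
    (h : u' ≤ u + δ) :
    1 + lam * u' + (lam * u') ^ 2 / 2 ≤ (1 + lam * u + (lam * u) ^ 2 / 2) * (1 + lam * δ + (lam * δ) ^ 2 / 2) := by
  have h1 : lam * u' ≤ lam * u + lam * δ := by nlinarith
  have h2 : (lam * u') ^ 2 ≤ (lam * u + lam * δ) ^ 2 := by
    have : 0 ≤ lam * u' := mul_nonneg hlam hu'
    nlinarith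
  nlinarith [mul_nonneg (mul_nonneg hlam hu) (mul_nonneg hlam hδ), mul_nonneg hlam hu, mul_nonneg hlam hδ,
    sq_nonneg (lam * u), sq_nonneg (lam * δ), mul_nonneg (sq_nonneg (lam * u)) (mul_nonneg hlam hδ),
    mul_nonneg (sq_nonneg (lam * δ)) (mul_nonneg hlam hu), mul_nonneg (sq_nonneg (lam * u)) (sq_nonneg (lam * δ))]

/-- Pointwise recentring of a second-order response PRODUCT: if `|c i − c' i| ≤ δ` on `T` (`λ, δ ≥ 0`) then
`∏_{i∈T}(1 + λ|k i − c' i| + (λ|k i − c' i|)²/2) ≤ exp(λδ·#T) · ∏_{i∈T}(1 + λ|k i − c i| + (λ|k i − c i|)²/2)`. [folklore] -/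
theorem prod_response₂_recentre_le {n : ℕ} (T : Finset (Fin n)) (k c c' : Fin n → ℝ) {lam δ : ℝ} (hlam : 0 ≤ lam)
    (hδ : 0 ≤ δ) (hclose : ∀ i ∈ T, |c i - c' i| ≤ δ) :
    ∏ i ∈ T, (1 + lam * |k i - c' i| + (lam * |k i - c' i|) ^ 2 / 2) ≤
      Real.exp (lam * δ * T.card) * ∏ i ∈ T, (1 + lam * |k i - c i| + (lam * |k i - c i|) ^ 2 / 2) := by
  have hpt : ∀ i ∈ T, 1 + lam * |k i - c' i| + (lam * |k i - c' i|) ^ 2 / 2 ≤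
      (1 + lam * |k i - c i| + (lam * |k i - c i|) ^ 2 / 2) * (1 + lam * δ + (lam * δ) ^ 2 / 2) := fun i hi => by
    refine one_add_quad_le_mul hlam (abs_nonneg _) (abs_nonneg _) hδ ?_
    calc |k i - c' i| ≤ |k i - c i| + |c i - c' i| := abs_sub_le _ _ _
      _ ≤ |k i - c i| + δ := by linarith [hclose i hi]
  calc ∏ i ∈ T, (1 + lam * |k i - c' i| + (lam * |k i - c' i|) ^ 2 / 2)
      ≤ ∏ i ∈ T, ((1 + lam * |k i - c i| + (lam * |k i - c i|) ^ 2 / 2) * (1 + lam * δ + (lam * δ) ^ 2 / 2)) :=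
        Finset.prod_le_prod (fun i _ => by positivity) hpt
    _ = (1 + lam * δ + (lam * δ) ^ 2 / 2) ^ T.card *
          ∏ i ∈ T, (1 + lam * |k i - c i| + (lam * |k i - c i|) ^ 2 / 2) := by
        rw [Finset.prod_mul_distrib, Finset.prod_const, mul_comm]
    _ ≤ Real.exp (lam * δ * T.card) * ∏ i ∈ T, (1 + lam * |k i - c i| + (lam * |k i - c i|) ^ 2 / 2) := by
        refine mul_le_mul_of_nonneg_right ?_ (Finset.prod_nonneg fun i _ => by positivity)
        calc (1 + lam * δ + (lam * δ) ^ 2 / 2) ^ T.card ≤ (Real.exp (lam * δ)) ^ T.card :=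
              pow_le_pow_left₀ (by positivity) (Real.quadratic_le_exp_of_nonneg (by positivity)) _
          _ = Real.exp (lam * δ * T.card) := by rw [← Real.exp_nat_mul]; ring_nf

/-- **Recentring a second-order response product at one coupling, one torus, one family.**  For `C₁ > 0` and centres
`c, c'` with `|c i − c' i| ≤ δ` (`δ ≥ 0`) on `T`:
`⟨∏(1 + Y'ᵢ + Y'ᵢ²/2)⟩_{2L+1,β} ≤ exp((R⁴/C₁)δ·#T)·⟨∏(1 + Yᵢ + Yᵢ²/2)⟩_{2L+1,β}`, `Y` about `c`, `Y'` about `c'`. [folklore] -/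
theorem torusE_prod_response₂_recentre (β : ℝ) (L : ℕ) {n : ℕ} (T : Finset (Fin n)) (q : Fin n → Fin 4 × Fin 4)
    (x : Fin n → (Fin 4 → ℤ)) (R : ℕ) {C₁ : ℝ} (hC₁ : 0 < C₁) (c c' : Fin n → ℝ) {δ : ℝ} (hδ : 0 ≤ δ)
    (hclose : ∀ i ∈ T, |c i - c' i| ≤ δ) :
    torusE G r β L (fun U => ∏ i ∈ T, (1 + (R : ℝ) ^ 4 / C₁ *
        |kerE G r β (fun k => x i k - (R + 1)) (2 * R + 3) U (plane G r (q i) (x i)) - c' i| + ((R : ℝ) ^ 4 / C₁ *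
        |kerE G r β (fun k => x i k - (R + 1)) (2 * R + 3) U (plane G r (q i) (x i)) - c' i|) ^ 2 / 2)) ≤
      Real.exp ((R : ℝ) ^ 4 / C₁ * δ * T.card) *
        torusE G r β L (fun U => ∏ i ∈ T, (1 + (R : ℝ) ^ 4 / C₁ *
          |kerE G r β (fun k => x i k - (R + 1)) (2 * R + 3) U (plane G r (q i) (x i)) - c i| + ((R : ℝ) ^ 4 / C₁ *
          |kerE G r β (fun k => x i k - (R + 1)) (2 * R + 3) U (plane G r (q i) (x i)) - c i|) ^ 2 / 2)) := by
  have hlam : 0 ≤ (R : ℝ) ^ 4 / C₁ := by positivity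
  have hpt := fun U : LGConfig 4 G => prod_response₂_recentre_le T
    (fun i => kerE G r β (fun k => x i k - (R + 1)) (2 * R + 3) U (plane G r (q i) (x i))) c c' hlam hδ hclose
  calc _ ≤ torusE G r β L (fun U => Real.exp ((R : ℝ) ^ 4 / C₁ * δ * T.card) *
          ∏ i ∈ T, (1 + (R : ℝ) ^ 4 / C₁ *
            |kerE G r β (fun k => x i k - (R + 1)) (2 * R + 3) U (plane G r (q i) (x i)) - c i| + ((R : ℝ) ^ 4 / C₁ *
            |kerE G r β (fun k => x i k - (R + 1)) (2 * R + 3) U (plane G r (q i) (x i)) - c i|) ^ 2 / 2)) :=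
        torusE_mono r β L (continuous_prod_response₂ r β T q x R _ _)
          (continuous_const.mul (continuous_prod_response₂ r β T q x R _ _)) hpt
    _ = _ := torusE_const_mul' r β L _ _

/-! ## §2 (PM₂) pins its reference values -/

/-- **(PM₂) pins its reference values** (through (PM₂) ⇒ (PM), p548315, and `abs_torusE_plane_sub_le_of_productMoments`, p544257):
on the guards, `|⟨plane q x⟩_{2L+1,β} − p q β| ≤ C₁(e^B − 1)/R⁴`. [folklore: Georgii (2011) Thm. 4.17] -/
theorem abs_torusE_plane_sub_le_of_productMoments₂ {C₁ B β₁ ℓ₁ : ℝ} {p : Fin 4 × Fin 4 → ℝ → ℝ} (hC₁ : 0 < C₁)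
    (hPM₂ : ∀ β : ℝ, β₁ ≤ β → ∀ (L n : ℕ) (q : Fin n → Fin 4 × Fin 4) (x : Fin n → (Fin 4 → ℤ)) (R : ℕ),
      (∀ i, (q i).1 < (q i).2) → 1 ≤ R → (R : ℝ) * a β ≤ ℓ₁ → 4 * R + 8 ≤ L →
      (∀ i j : Fin n, i ≠ j → ∃ k : Fin 4,
        (2 * (R : ℤ) + 4) ≤ |((((x i k - x j k : ℤ) : ZMod (2 * L + 1))).valMinAbs : ℤ)|) →
      ∀ T : Finset (Fin n),
        torusE G r β L (fun U => ∏ i ∈ T, (1 + (R : ℝ) ^ 4 / C₁ *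
          |kerE G r β (fun k => x i k - (R + 1)) (2 * R + 3) U (plane G r (q i) (x i)) - p (q i) β| + ((R : ℝ) ^ 4 / C₁ *
          |kerE G r β (fun k => x i k - (R + 1)) (2 * R + 3) U (plane G r (q i) (x i)) - p (q i) β|) ^ 2 / 2)) ≤
          Real.exp (B * T.card))
    {β : ℝ} (hβ : β₁ ≤ β) {L R : ℕ} (q : Fin 4 × Fin 4) (x : Fin 4 → ℤ) (hq : q.1 < q.2) (hR : 1 ≤ R)
    (hRa : (R : ℝ) * a β ≤ ℓ₁) (hRL : 4 * R + 8 ≤ L) :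
    |torusE G r β L (plane G r q x) - p q β| ≤ C₁ * (Real.exp B - 1) / (R : ℝ) ^ 4 :=
  abs_torusE_plane_sub_le_of_productMoments r a hC₁ (productMoments_of_productMoments₂ r a hC₁ hPM₂) hβ q x hq hR
    hRa hRL

/-! ## §3 The two (PM₂) conversions -/

/-- **(PM₂) conversion 1: reference values ⇒ torus means** — `B ↦ B + e^B − 1`. [folklore] -/
theorem productMoments₂Centred_of_productMoments₂ {C₁ B β₁ ℓ₁ : ℝ} {p : Fin 4 × Fin 4 → ℝ → ℝ} (hC₁ : 0 < C₁)
    (hPM₂ : ∀ β : ℝ, β₁ ≤ β → ∀ (L n : ℕ) (q : Fin n → Fin 4 × Fin 4) (x : Fin n → (Fin 4 → ℤ)) (R : ℕ),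
      (∀ i, (q i).1 < (q i).2) → 1 ≤ R → (R : ℝ) * a β ≤ ℓ₁ → 4 * R + 8 ≤ L →
      (∀ i j : Fin n, i ≠ j → ∃ k : Fin 4,
        (2 * (R : ℤ) + 4) ≤ |((((x i k - x j k : ℤ) : ZMod (2 * L + 1))).valMinAbs : ℤ)|) →
      ∀ T : Finset (Fin n),
        torusE G r β L (fun U => ∏ i ∈ T, (1 + (R : ℝ) ^ 4 / C₁ *
          |kerE G r β (fun k => x i k - (R + 1)) (2 * R + 3) U (plane G r (q i) (x i)) - p (q i) β| + ((R : ℝ) ^ 4 / C₁ *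
          |kerE G r β (fun k => x i k - (R + 1)) (2 * R + 3) U (plane G r (q i) (x i)) - p (q i) β|) ^ 2 / 2)) ≤
          Real.exp (B * T.card)) :
    ∀ β : ℝ, β₁ ≤ β → ∀ (L n : ℕ) (q : Fin n → Fin 4 × Fin 4) (x : Fin n → (Fin 4 → ℤ)) (R : ℕ),
      (∀ i, (q i).1 < (q i).2) → 1 ≤ R → (R : ℝ) * a β ≤ ℓ₁ → 4 * R + 8 ≤ L →
      (∀ i j : Fin n, i ≠ j → ∃ k : Fin 4,
        (2 * (R : ℤ) + 4) ≤ |((((x i k - x j k : ℤ) : ZMod (2 * L + 1))).valMinAbs : ℤ)|) →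
      ∀ T : Finset (Fin n),
        torusE G r β L (fun U => ∏ i ∈ T, (1 + (R : ℝ) ^ 4 / C₁ *
          |kerE G r β (fun k => x i k - (R + 1)) (2 * R + 3) U (plane G r (q i) (x i)) -
            torusE G r β L (plane G r (q i) (x i))| + ((R : ℝ) ^ 4 / C₁ *
          |kerE G r β (fun k => x i k - (R + 1)) (2 * R + 3) U (plane G r (q i) (x i)) -
            torusE G r β L (plane G r (q i) (x i))|) ^ 2 / 2)) ≤
          Real.exp ((B + (Real.exp B - 1)) * T.card) := by
  intro β hβ L n q x R hq hR hRa hRL hsep T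
  have hR0 : (0 : ℝ) < R := by exact_mod_cast (show 0 < R by omega)
  have hclose : ∀ i ∈ T, |p (q i) β - torusE G r β L (plane G r (q i) (x i))| ≤
      C₁ * (Real.exp B - 1) / (R : ℝ) ^ 4 := fun i _ => by
    rw [abs_sub_comm]
    exact abs_torusE_plane_sub_le_of_productMoments₂ r a hC₁ hPM₂ hβ (q i) (x i) (hq i) hR hRa hRL
  rcases T.eq_empty_or_nonempty with hT | ⟨i₀, hi₀⟩
  · subst hT
    have h0 := hPM₂ β hβ L n q x R hq hR hRa hRL hsep ∅
    simpa using h0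
  have hδ0 : 0 ≤ C₁ * (Real.exp B - 1) / (R : ℝ) ^ 4 := (abs_nonneg _).trans (hclose i₀ hi₀)
  have hδ : (R : ℝ) ^ 4 / C₁ * (C₁ * (Real.exp B - 1) / (R : ℝ) ^ 4) * T.card = (Real.exp B - 1) * T.card := by
    field_simp
  calc _ ≤ Real.exp ((R : ℝ) ^ 4 / C₁ * (C₁ * (Real.exp B - 1) / (R : ℝ) ^ 4) * T.card) *
          torusE G r β L (fun U => ∏ i ∈ T, (1 + (R : ℝ) ^ 4 / C₁ *
            |kerE G r β (fun k => x i k - (R + 1)) (2 * R + 3) U (plane G r (q i) (x i)) - p (q i) β| + ((R : ℝ) ^ 4 / C₁ *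
            |kerE G r β (fun k => x i k - (R + 1)) (2 * R + 3) U (plane G r (q i) (x i)) - p (q i) β|) ^ 2 / 2)) :=
        torusE_prod_response₂_recentre r β L T q x R hC₁ (fun i => p (q i) β)
          (fun i => torusE G r β L (plane G r (q i) (x i))) hδ0 hclose
    _ ≤ Real.exp ((Real.exp B - 1) * T.card) * Real.exp (B * T.card) := by
        rw [hδ]
        exact mul_le_mul_of_nonneg_left (hPM₂ β hβ L n q x R hq hR hRa hRL hsep T) (Real.exp_nonneg _)
    _ = Real.exp ((B + (Real.exp B - 1)) * T.card) := by rw [← Real.exp_add]; ring_nf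

/-- **(PM₂) conversion 2: torus means + finite-size pinning ⇒ reference values** — `B ↦ B + D/C₁`. [folklore] -/
theorem productMoments₂_of_centred_of_pinned {C₁ B D β₁ ℓ₁ : ℝ} {p : Fin 4 × Fin 4 → ℝ → ℝ} (hC₁ : 0 < C₁)
    (hcen : ∀ β : ℝ, β₁ ≤ β → ∀ (L n : ℕ) (q : Fin n → Fin 4 × Fin 4) (x : Fin n → (Fin 4 → ℤ)) (R : ℕ),
      (∀ i, (q i).1 < (q i).2) → 1 ≤ R → (R : ℝ) * a β ≤ ℓ₁ → 4 * R + 8 ≤ L →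
      (∀ i j : Fin n, i ≠ j → ∃ k : Fin 4,
        (2 * (R : ℤ) + 4) ≤ |((((x i k - x j k : ℤ) : ZMod (2 * L + 1))).valMinAbs : ℤ)|) →
      ∀ T : Finset (Fin n),
        torusE G r β L (fun U => ∏ i ∈ T, (1 + (R : ℝ) ^ 4 / C₁ *
          |kerE G r β (fun k => x i k - (R + 1)) (2 * R + 3) U (plane G r (q i) (x i)) -
            torusE G r β L (plane G r (q i) (x i))| + ((R : ℝ) ^ 4 / C₁ *
          |kerE G r β (fun k => x i k - (R + 1)) (2 * R + 3) U (plane G r (q i) (x i)) -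
            torusE G r β L (plane G r (q i) (x i))|) ^ 2 / 2)) ≤
          Real.exp (B * T.card))
    (hpin : ∀ β : ℝ, β₁ ≤ β → ∀ (L : ℕ) (q : Fin 4 × Fin 4) (x : Fin 4 → ℤ) (R : ℕ), q.1 < q.2 → 1 ≤ R →
      (R : ℝ) * a β ≤ ℓ₁ → 4 * R + 8 ≤ L → |torusE G r β L (plane G r q x) - p q β| ≤ D / (R : ℝ) ^ 4) :
    ∀ β : ℝ, β₁ ≤ β → ∀ (L n : ℕ) (q : Fin n → Fin 4 × Fin 4) (x : Fin n → (Fin 4 → ℤ)) (R : ℕ),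
      (∀ i, (q i).1 < (q i).2) → 1 ≤ R → (R : ℝ) * a β ≤ ℓ₁ → 4 * R + 8 ≤ L →
      (∀ i j : Fin n, i ≠ j → ∃ k : Fin 4,
        (2 * (R : ℤ) + 4) ≤ |((((x i k - x j k : ℤ) : ZMod (2 * L + 1))).valMinAbs : ℤ)|) →
      ∀ T : Finset (Fin n),
        torusE G r β L (fun U => ∏ i ∈ T, (1 + (R : ℝ) ^ 4 / C₁ *
          |kerE G r β (fun k => x i k - (R + 1)) (2 * R + 3) U (plane G r (q i) (x i)) - p (q i) β| + ((R : ℝ) ^ 4 / C₁ *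
          |kerE G r β (fun k => x i k - (R + 1)) (2 * R + 3) U (plane G r (q i) (x i)) - p (q i) β|) ^ 2 / 2)) ≤
          Real.exp ((B + D / C₁) * T.card) := by
  intro β hβ L n q x R hq hR hRa hRL hsep T
  have hR0 : (0 : ℝ) < R := by exact_mod_cast (show 0 < R by omega)
  have hclose : ∀ i ∈ T, |torusE G r β L (plane G r (q i) (x i)) - p (q i) β| ≤ D / (R : ℝ) ^ 4 :=
    fun i _ => hpin β hβ L (q i) (x i) R (hq i) hR hRa hRL
  rcases T.eq_empty_or_nonempty with hT | ⟨i₀, hi₀⟩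
  · subst hT
    have h0 := hcen β hβ L n q x R hq hR hRa hRL hsep ∅
    simpa using h0
  have hD : 0 ≤ D / (R : ℝ) ^ 4 := (abs_nonneg _).trans (hclose i₀ hi₀)
  have hδ : (R : ℝ) ^ 4 / C₁ * (D / (R : ℝ) ^ 4) * T.card = D / C₁ * T.card := by
    field_simp
  calc _ ≤ Real.exp ((R : ℝ) ^ 4 / C₁ * (D / (R : ℝ) ^ 4) * T.card) *
          torusE G r β L (fun U => ∏ i ∈ T, (1 + (R : ℝ) ^ 4 / C₁ *
            |kerE G r β (fun k => x i k - (R + 1)) (2 * R + 3) U (plane G r (q i) (x i)) -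
              torusE G r β L (plane G r (q i) (x i))| + ((R : ℝ) ^ 4 / C₁ *
            |kerE G r β (fun k => x i k - (R + 1)) (2 * R + 3) U (plane G r (q i) (x i)) -
              torusE G r β L (plane G r (q i) (x i))|) ^ 2 / 2)) :=
        torusE_prod_response₂_recentre r β L T q x R hC₁ (fun i => torusE G r β L (plane G r (q i) (x i)))
          (fun i => p (q i) β) hD hclose
    _ ≤ Real.exp (D / C₁ * T.card) * Real.exp (B * T.card) := by
        rw [hδ]
        exact mul_le_mul_of_nonneg_left (hcen β hβ L n q x R hq hR hRa hRL hsep T) (Real.exp_nonneg _)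
    _ = Real.exp ((B + D / C₁) * T.card) := by rw [← Real.exp_add]; ring_nf

/-! ## §4 The press-button at the unit of record for `SU(2)` in the fundamental representation -/

/-- **The registered `stub_ceilings` conclusion from the SECOND-ORDER product-moment input.**  For `SU(2)` (Borel structure)
in the fundamental representation: (PM₂) at a unit `a` with `a β ≤ c·uRec β` eventually (`c > 0`; reference values `p`,
`C₁ > 0`, `B`, `ℓ₁ > 0`, `β₁`, `P₀`) ⇒ `MomentBounds6 (SU(2)) rF Transport.uRec` VERBATIM ((PM₂) ⇒ (PM), p548315, then
`stubCeilings_of_productMoments`, p544257).  A v6 with ONE non-fed stub `stub_productMoments₂Odd6 : UV → (this hypothesis)`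
closes `stub_ceilings` by `exact stubCeilings_of_productMoments₂ (…)` AND feeds the α′ floors' mean-square law through
`torusE_sq_response_le_of_productMoments₂`. [folklore] -/
theorem stubCeilings_of_productMoments₂
    (h : letI : MeasurableSpace (Matrix.specialUnitaryGroup (Fin 2) ℂ) := borel _
      haveI : BorelSpace (Matrix.specialUnitaryGroup (Fin 2) ℂ) := ⟨rfl⟩
      ∃ (a : ℝ → ℝ) (c : ℝ) (C₁ B β₁ ℓ₁ P₀ : ℝ) (p : Fin 4 × Fin 4 → ℝ → ℝ), 0 < c ∧
        (∀ᶠ β in atTop, a β ≤ c * Transport.uRec β) ∧ 0 < ℓ₁ ∧ 0 < C₁ ∧ (∀ q β, |p q β| ≤ P₀) ∧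
        ∀ β : ℝ, β₁ ≤ β → ∀ (L n : ℕ) (q : Fin n → Fin 4 × Fin 4) (x : Fin n → (Fin 4 → ℤ)) (R : ℕ),
          (∀ i, (q i).1 < (q i).2) → 1 ≤ R → (R : ℝ) * a β ≤ ℓ₁ → 4 * R + 8 ≤ L →
          (∀ i j : Fin n, i ≠ j → ∃ k : Fin 4,
            (2 * (R : ℤ) + 4) ≤ |((((x i k - x j k : ℤ) : ZMod (2 * L + 1))).valMinAbs : ℤ)|) →
          ∀ T : Finset (Fin n),
            torusE (Matrix.specialUnitaryGroup (Fin 2) ℂ) (fundamentalLatticeRep 2) β L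
              (fun U => ∏ i ∈ T, (1 + (R : ℝ) ^ 4 / C₁ *
                |kerE (Matrix.specialUnitaryGroup (Fin 2) ℂ) (fundamentalLatticeRep 2) β
                  (fun k => x i k - (R + 1)) (2 * R + 3) U
                  (plane (Matrix.specialUnitaryGroup (Fin 2) ℂ) (fundamentalLatticeRep 2) (q i) (x i)) -
                  p (q i) β| + ((R : ℝ) ^ 4 / C₁ *
                |kerE (Matrix.specialUnitaryGroup (Fin 2) ℂ) (fundamentalLatticeRep 2) β
                  (fun k => x i k - (R + 1)) (2 * R + 3) U
                  (plane (Matrix.specialUnitaryGroup (Fin 2) ℂ) (fundamentalLatticeRep 2) (q i) (x i)) -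
                  p (q i) β|) ^ 2 / 2)) ≤ Real.exp (B * T.card)) :
    letI : MeasurableSpace (Matrix.specialUnitaryGroup (Fin 2) ℂ) := borel _
    haveI : BorelSpace (Matrix.specialUnitaryGroup (Fin 2) ℂ) := ⟨rfl⟩
    MomentBounds6 (Matrix.specialUnitaryGroup (Fin 2) ℂ) (fundamentalLatticeRep 2) Transport.uRec := by
  letI : MeasurableSpace (Matrix.specialUnitaryGroup (Fin 2) ℂ) := borel _
  haveI : BorelSpace (Matrix.specialUnitaryGroup (Fin 2) ℂ) := ⟨rfl⟩
  obtain ⟨a, c, C₁, B, β₁, ℓ₁, P₀, p, hc, hle, hℓ₁, hC₁, hp, hPM₂⟩ := h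
  exact momentBounds6_of_productMoments_eventually (fundamentalLatticeRep 2) hc hle hℓ₁ hC₁ hp
    (productMoments_of_productMoments₂ (fundamentalLatticeRep 2) a hC₁ hPM₂)

end Summit.QuantumFields.YangMills.Cruxes.UVSeamRec.ProductMoments

end
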